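import Literature.NumberTheory.GaloisRepresentations.LubinTateColemanRelativeLiftTwo
import Literature.NumberTheory.GaloisRepresentations.UnramifiedKummer
import Literature.NumberTheory.GaloisRepresentations.LocalGaloisGroupFrobeniusProofs
import HarnessLib

/-!
# The Frobenius automorphism of `𝒪_E` for an unramified `E/F`, and de Shalit's twisted lift `𝒩_E G = G^φ`

Let `F` be a non-archimedean local field with uniformiser `π`, `F̄ = AlgebraicClosure F`, and
`E ⊆ F̄` a finite subextension with valuation ring `𝒪_E = unitBall E` (spectral norm, the local
instances `rk1 nF nE` of `LubinTateTorsion`).  This file supplies the arithmetic input that the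
power-series files `LubinTateColemanRelative*Two` kept abstract as a ring automorphism
`ψ : 𝒪_E ≃+* 𝒪_E` with `ψ(π) = π` and `ψ(c) ≡ c^q (mod π)`:

* `norm_coe_eq_algNorm` — the spectral norm of `E` is the absolute value `algNorm F` of `F̄`;
* `exists_eq_algebraMap_mul_of_norm_lt_one` — **for `E ⊆ F^{nr} = maxUnramified F` the maximal
  ideal of `𝒪_E` is `π𝒪_E`** (`‖x‖ < 1 ⇒ x ∈ π𝒪_E`; value group `‖π‖^ℤ`,
  `exists_algNorm_eq_zpow_of_mem_maxUnramified`);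
* `unitBallEquiv σ : 𝒪_E ≃+* 𝒪_E` — an `F`-automorphism of `E` restricted to `𝒪_E`
  (`toUnitBallHom`), fixing `𝒪[F]` (`unitBallEquiv_algebraMap`);
* `unitBallEquiv_sub_pow_mem` — if `σ` is the restriction of an arithmetic Frobenius
  `σ₀ ∈ Γ_F` (`IsAbsArithFrob`) and `E ⊆ F^{nr}`, then **`σ(c) - c^q ∈ π𝒪_E`** for all `c ∈ 𝒪_E`;
* `exists_frobenius_unitBall` — for `E ⊆ F^{nr}` finite and normal over `F` there is
  `φ : 𝒪_E ≃+* 𝒪_E` with `φ|𝒪[F] = id` and `φ(c) ≡ c^q (mod π)` (restriction of a Frobenius,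
  `exists_isAbsArithFrob_holds`, `AlgEquiv.restrictNormal`);
* `exists_relNormTwo_eq_map_frobenius` (`q = 2`) — **de Shalit's I §3.10 over an unramified base
  with the genuine Frobenius**: every unit `g ∈ 𝒪_E⟦X⟧ˣ` has a lift `G ≡ g (mod π)` with
  `𝒩_E G = G^φ` (`exists_relNormTwo_eq_map_sub_mem` of `LubinTateColemanRelativeLiftTwo`).
* `smul_eq_smul_of_isAbsArithFrob`, `unitBallEquiv_restrictNormal_eq_of_isAbsArithFrob` — two
  arithmetic Frobenius elements agree on `F^{nr}`, so **the Frobenius of `𝒪_E` is well defined**;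
  `inclUnitBall_unitBallEquiv_restrictNormal`, `map_inclUnitBall_map_unitBallEquiv_restrictNormal` —
  compatibility with the inclusions `𝒪_{E₁} → 𝒪_{E₂}` (`E₁ ≤ E₂`), elementwise and coefficientwise.

References: E. de Shalit, *Iwasawa theory of elliptic curves with complex multiplication* (1987),
Ch. I §1.1 (unramified extensions, Frobenius `φ`), §2.1–2.2, §3.10 (the relative situation
`k' ⊇ k` unramified, `𝒩 G = G^φ`); J.-P. Serre, *Local Fields* (1979), Ch. I §7–8, Ch. II §2,
Ch. IV §4 Cor. 2 to Prop. 16.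
-/

noncomputable section

open scoped PowerSeries.WithPiTopology

namespace Literature.NumberTheory.GaloisRepresentations

section UnramifiedFrobenius

open GaloisRepresentations.IsNonarchimedeanLocalField LubinTate ValuativeRel Field

variable (F : Type*) [Field F] [ValuativeRel F] [TopologicalSpace F] [IsNonarchimedeanLocalField F]

attribute [local instance] ltNormUniformSpace ltNormIsUniformAddGroup rk1 nF nE fintypeResidueField

variable {F}
variable {π : 𝒪[F]} (hπ : (valuation F).IsUniformizer (π : F))
variable (E : IntermediateField F (AlgebraicClosure F)) [FiniteDimensional F E]

/-! ### The spectral norm of `E` and the absolute value of `F̄` -/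

/-- The (spectral) norm of a finite subextension `E ⊆ F̄` is the restriction of the absolute value
`algNorm F` of `F̄` (the spectral norm depends only on the minimal polynomial).
[cite: SerreLocalFields1979, Ch. II §2 Cor. 3] -/
theorem norm_coe_eq_algNorm (x : E) : ‖x‖ = algNorm F (x : AlgebraicClosure F) := by
  rw [norm_eq_spectralNorm F E, spectralNorm.eq_of_tower (K := F) (E := E) (L := AlgebraicClosure F) x,
    algNorm_def]
  rfl

/-- The image of `π` in `E ⊆ F̄` is the image of `π` in `F̄` (unfolding). [folklore] -/
private theorem coe_algebraMap_pi (a : 𝒪[F]) :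
    (((algebraMap 𝒪[F] (unitBall E) a : unitBall E) : E) : AlgebraicClosure F) =
      algebraMap 𝒪[F] (AlgebraicClosure F) a := by
  rw [algebraMap_integer_apply, IsScalarTower.algebraMap_apply 𝒪[F] F (AlgebraicClosure F)]
  rfl

include hπ in
/-- A uniformiser is irreducible. [folklore] -/
private theorem irreducible_pi : Irreducible π :=
  IsDiscreteValuationRing.irreducible_of_span_eq_maximalIdeal π
    (fun h => hπ.ne_zero (by rw [h]; rfl)) (maximalIdeal_eq_span_singleton hπ)

include hπ in
/-- `‖π‖ < 1` in `E`. [cite: SerreLocalFields1979, Ch. II §2 Cor. 3] -/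
theorem norm_algebraMap_pi_lt_one : ‖((algebraMap 𝒪[F] (unitBall E) π : unitBall E) : E)‖ < 1 := by
  rw [norm_coe_eq_algNorm, coe_algebraMap_pi]
  exact algNorm_uniformizer_lt_one (irreducible_pi hπ)

include hπ in
/-- `0 < ‖π‖` in `E`. [cite: SerreLocalFields1979, Ch. II §2 Cor. 3] -/
theorem norm_algebraMap_pi_pos : 0 < ‖((algebraMap 𝒪[F] (unitBall E) π : unitBall E) : E)‖ := by
  rw [norm_coe_eq_algNorm, coe_algebraMap_pi]
  exact algNorm_uniformizer_pos (irreducible_pi hπ)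

/-! ### For `E ⊆ F^{nr}` the maximal ideal of `𝒪_E` is `π𝒪_E` -/

include hπ in
/-- ★ **`E/F` unramified ⇒ `𝔪_E = π𝒪_E`**: for `E ⊆ F^{nr} = maxUnramified F` and `x ∈ 𝒪_E` with
`‖x‖ < 1` there is `y ∈ 𝒪_E` with `x = π y` (the value group of `E` is `‖π‖^ℤ`, so `‖x‖ = ‖π‖^n` with
`n ≥ 1` and `‖x/π‖ ≤ 1`). [cite: SerreLocalFields1979, Ch. IV §4 Cor. 2 to Prop. 16] -/
theorem exists_eq_algebraMap_mul_of_norm_lt_one (hE : E ≤ maxUnramified F) {x : unitBall E}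
    (hx : ‖(x : E)‖ < 1) : ∃ y : unitBall E, x = algebraMap 𝒪[F] (unitBall E) π * y := by
  by_cases hx0 : (x : E) = 0
  · exact ⟨0, Subtype.ext (by rw [hx0, mul_zero]; rfl)⟩
  have hxF : ((x : E) : AlgebraicClosure F) ≠ 0 := fun h => hx0 (by exact_mod_cast h)
  obtain ⟨n, hn⟩ := exists_algNorm_eq_zpow_of_mem_maxUnramified (irreducible_pi hπ) (hE (x : E).2) hxF
  have hc0 := norm_algebraMap_pi_pos hπ E
  have hc1 := norm_algebraMap_pi_lt_one hπ E
  have hπE : (((algebraMap 𝒪[F] (unitBall E) π : unitBall E) : E)) ≠ 0 := norm_pos_iff.mp hc0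
  rw [norm_coe_eq_algNorm, coe_algebraMap_pi] at hc0 hc1
  rw [norm_coe_eq_algNorm, hn] at hx
  -- `n ≥ 1`
  have hn1 : 1 ≤ n := by
    by_contra h
    have h' : n ≤ 0 := by omega
    exact absurd hx (not_lt.mpr (one_le_zpow_of_nonpos₀ hc0 hc1.le h'))
  obtain ⟨m, rfl⟩ : ∃ m : ℕ, n = (m : ℤ) + 1 := ⟨(n - 1).toNat, by omega⟩
  refine ⟨⟨(x : E) / ((algebraMap 𝒪[F] (unitBall E) π : unitBall E) : E), ?_⟩, Subtype.ext ?_⟩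
  · rw [mem_unitBall_iff, norm_div, norm_coe_eq_algNorm, norm_coe_eq_algNorm, hn, coe_algebraMap_pi,
      zpow_add_one₀ hc0.ne', zpow_natCast, mul_div_cancel_right₀ _ hc0.ne']
    exact pow_le_one₀ hc0.le hc1.le
  · change (x : E) = ((algebraMap 𝒪[F] (unitBall E) π : unitBall E) : E) * ((x : E) / _)
    rw [mul_div_cancel₀ _ hπE]

include hπ in
/-- For `E ⊆ F^{nr}`: `‖x‖ < 1 ↔ x ∈ π𝒪_E` (`x ∈ 𝒪_E`).
[cite: SerreLocalFields1979, Ch. IV §4 Cor. 2 to Prop. 16] -/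
theorem norm_lt_one_iff_mem_span_algebraMap_pi (hE : E ≤ maxUnramified F) (x : unitBall E) :
    ‖(x : E)‖ < 1 ↔ x ∈ Ideal.span {algebraMap 𝒪[F] (unitBall E) π} := by
  constructor
  · intro hx
    obtain ⟨y, hy⟩ := exists_eq_algebraMap_mul_of_norm_lt_one hπ E hE hx
    exact Ideal.mem_span_singleton'.mpr ⟨y, by rw [hy, mul_comm]⟩
  · intro hx
    obtain ⟨y, hy⟩ := Ideal.mem_span_singleton'.mp hx
    rw [← hy]
    change ‖((y : unitBall E) : E) * ((algebraMap 𝒪[F] (unitBall E) π : unitBall E) : E)‖ < 1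
    rw [norm_mul]
    calc ‖((y : unitBall E) : E)‖ * ‖((algebraMap 𝒪[F] (unitBall E) π : unitBall E) : E)‖
        ≤ 1 * ‖((algebraMap 𝒪[F] (unitBall E) π : unitBall E) : E)‖ :=
          mul_le_mul_of_nonneg_right ((mem_unitBall_iff E).mp y.2) (norm_nonneg _)
      _ < 1 := by rw [one_mul]; exact norm_algebraMap_pi_lt_one hπ E

/-! ### `F`-automorphisms of `E` on `𝒪_E` -/

/-- An `F`-automorphism `σ` of `E` restricted to the valuation ring, as a ring automorphism
`𝒪_E ≃+* 𝒪_E` (`σ` is an isometry, `toUnitBallHom`). [cite: SerreLocalFields1979, Ch. II §2 Cor. 3] -/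
def unitBallEquiv (σ : E ≃ₐ[F] E) : unitBall E ≃+* unitBall E where
  toFun := toUnitBallHom σ
  invFun := toUnitBallHom σ.symm
  left_inv x := Subtype.ext (by
    change σ.symm (σ (x : E)) = x
    exact σ.symm_apply_apply _)
  right_inv x := Subtype.ext (by
    change σ (σ.symm (x : E)) = x
    exact σ.apply_symm_apply _)
  map_mul' x y := map_mul (toUnitBallHom σ) x y
  map_add' x y := map_add (toUnitBallHom σ) x y

omit [FiniteDimensional F E] in
/-- `unitBallEquiv σ x = σ x` (unfolding). [cite: SerreLocalFields1979, Ch. II §2 Cor. 3] -/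
theorem coe_unitBallEquiv [FiniteDimensional F E] (σ : E ≃ₐ[F] E) (x : unitBall E) :
    ((unitBallEquiv E σ x : unitBall E) : E) = σ x := rfl

/-- `unitBallEquiv σ` fixes `𝒪[F]`. [cite: SerreLocalFields1979, Ch. II §2 Cor. 3] -/
theorem unitBallEquiv_algebraMap (σ : E ≃ₐ[F] E) (a : 𝒪[F]) :
    unitBallEquiv E σ (algebraMap 𝒪[F] (unitBall E) a) = algebraMap 𝒪[F] (unitBall E) a :=
  Subtype.ext (by rw [coe_unitBallEquiv, algebraMap_integer_apply]; exact σ.commutes _)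

/-- Elements of `𝒪_E` are absolute integers: `(c : F̄) ∈ S = absIntegers 𝒪[F] F`.
[cite: SerreLocalFields1979, Ch. II §2 Prop. 3] -/
theorem coe_mem_absIntegers (c : unitBall E) : ((c : E) : AlgebraicClosure F) ∈ absIntegers 𝒪[F] F :=
  mem_absIntegers_iff_algNorm_le_one.mpr (by rw [← norm_coe_eq_algNorm]; exact (mem_unitBall_iff E).mp c.2)

include hπ in
/-- ★★ **The Frobenius congruence on `𝒪_E`**: if `σ ∈ Aut(E/F)` is the restriction of an arithmetic
Frobenius `σ₀ ∈ Γ_F` (`σ₀ x ≡ x^q (mod 𝔓)` on the absolute integers) and `E ⊆ F^{nr}`, then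
`σ(c) - c^q ∈ π𝒪_E` for every `c ∈ 𝒪_E` (`𝔓 ∩ 𝒪_E = 𝔪_E = π𝒪_E`).
[cite: SerreLocalFields1979, Ch. I §8; Ch. IV §4 Cor. 2 to Prop. 16] -/
theorem unitBallEquiv_sub_pow_mem (hE : E ≤ maxUnramified F) {σ₀ : absoluteGaloisGroup F}
    (hσ₀ : IsAbsArithFrob σ₀) (σ : E ≃ₐ[F] E)
    (hσ : ∀ x : E, ((σ x : E) : AlgebraicClosure F) = σ₀ • ((x : E) : AlgebraicClosure F))
    (c : unitBall E) :
    unitBallEquiv E σ c - c ^ residueFieldCard F ∈ Ideal.span {algebraMap 𝒪[F] (unitBall E) π} := by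
  have h1 := isAbsArithFrob_iff_holds.mp hσ₀ ⟨_, coe_mem_absIntegers E c⟩
  rw [mem_absMaximalIdeal_iff_algNorm_lt_one] at h1
  refine (norm_lt_one_iff_mem_span_algebraMap_pi hπ E hE _).mp ?_
  rw [norm_coe_eq_algNorm]
  convert h1 using 2
  push_cast
  rw [coe_unitBallEquiv, hσ, integralClosure.coe_smul]

omit [ValuativeRel F] [TopologicalSpace F] [IsNonarchimedeanLocalField F] [FiniteDimensional F E] in
/-- The restriction to a normal `E` of `σ₀ ∈ Γ_F` acts as `σ₀` (Mathlib `AlgEquiv.restrictNormal_commutes`).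
[cite: SerreLocalFields1979, Ch. I §7 Prop. 20] -/
theorem coe_restrictNormal_apply [Normal F E] (σ₀ : absoluteGaloisGroup F) (x : E) :
    ((((absoluteGaloisGroup.toAlgEquiv F σ₀).restrictNormal E) x : E) : AlgebraicClosure F) =
      σ₀ • ((x : E) : AlgebraicClosure F) :=
  AlgEquiv.restrictNormal_commutes _ E x

include hπ in
/-- ★★ **The Frobenius automorphism of `𝒪_E`** for `E ⊆ F^{nr}` finite and normal over `F`: there is a
ring automorphism `φ` of `𝒪_E` fixing `𝒪[F]` with `φ(c) ≡ c^q (mod π)` for all `c` — the restriction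
of an arithmetic Frobenius of `Γ_F` (`exists_isAbsArithFrob_holds`).
[cite: SerreLocalFields1979, Ch. I §8 and Ch. IV §4 Cor. 2 to Prop. 16] -/
theorem exists_frobenius_unitBall [Normal F E] (hE : E ≤ maxUnramified F) :
    ∃ φ : unitBall E ≃+* unitBall E,
      (∀ a : 𝒪[F], φ (algebraMap 𝒪[F] (unitBall E) a) = algebraMap 𝒪[F] (unitBall E) a) ∧
      ∀ c : unitBall E, φ c - c ^ residueFieldCard F ∈ Ideal.span {algebraMap 𝒪[F] (unitBall E) π} := by
  obtain ⟨σ₀, hσ₀⟩ := exists_isAbsArithFrob_holds F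
  exact ⟨unitBallEquiv E ((absoluteGaloisGroup.toAlgEquiv F σ₀).restrictNormal E),
    unitBallEquiv_algebraMap E _,
    unitBallEquiv_sub_pow_mem hπ E hE hσ₀ _ (coe_restrictNormal_apply E σ₀)⟩

/-! ### De Shalit's I §3.10 over an unramified base, with the genuine Frobenius (`q = 2`) -/

/-- ★★★ **`𝒩_E G = G^φ` with `φ` the Frobenius** (`q = 2`, `E ⊆ F^{nr}` finite normal over `F`,
`σ₀ ∈ Γ_F` an arithmetic Frobenius, `φ = σ₀|_{𝒪_E}`): every unit `g ∈ 𝒪_E⟦X⟧ˣ` has a `G ≡ g (mod π)`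
with `𝒩_E G = G^φ` — de Shalit's I §3.10 Lemma in the relative (unramified-base) situation, the
abstract `ψ` of `exists_relNormTwo_eq_map_sub_mem` being discharged by `unitBallEquiv_sub_pow_mem`.
[cite: deShalit1987, Ch. I §3.10 Lemma] -/
theorem exists_relNormTwo_eq_map_frobenius [Normal F E] (hq : residueFieldCard F = 2)
    (hE : E ≤ maxUnramified F) {σ₀ : absoluteGaloisGroup F} (hσ₀ : IsAbsArithFrob σ₀)
    (g : (PowerSeries (unitBall E))ˣ) :
    ∃ G : PowerSeries (unitBall E),
      relNormTwo hπ E hq G =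
          PowerSeries.map (unitBallEquiv E ((absoluteGaloisGroup.toAlgEquiv F σ₀).restrictNormal E) :
            unitBall E →+* unitBall E) G ∧
        G - g ∈ coeffIdeal (Ideal.span {algebraMap 𝒪[F] (unitBall E) π}) :=
  exists_relNormTwo_eq_map_sub_mem hπ E hq _ (unitBallEquiv_algebraMap E _ π)
    (fun c => by
      have h := unitBallEquiv_sub_pow_mem hπ E hE hσ₀ _ (coe_restrictNormal_apply E σ₀) c
      rwa [hq] at h) g

/-- ★★ **Uniqueness of the Frobenius-twisted lift among units** (`q = 2`; here `σ₀ ∈ Γ_F` is arbitrary):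
a unit `G'` with `𝒩_E G' = G'^{σ₀}` congruent mod `π` to a `G` with `𝒩_E G = G^{σ₀}` equals `G`.
[cite: deShalit1987, Ch. I §3.10 Lemma] -/
theorem eq_of_relNormTwo_eq_map_frobenius [Normal F E] (hq : residueFieldCard F = 2)
    (σ₀ : absoluteGaloisGroup F) {G G' : PowerSeries (unitBall E)} (hG' : IsUnit G')
    (hN : relNormTwo hπ E hq G =
      PowerSeries.map (unitBallEquiv E ((absoluteGaloisGroup.toAlgEquiv F σ₀).restrictNormal E) :
        unitBall E →+* unitBall E) G)
    (hN' : relNormTwo hπ E hq G' =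
      PowerSeries.map (unitBallEquiv E ((absoluteGaloisGroup.toAlgEquiv F σ₀).restrictNormal E) :
        unitBall E →+* unitBall E) G')
    (h : G - G' ∈ coeffIdeal (Ideal.span {algebraMap 𝒪[F] (unitBall E) π})) : G = G' :=
  eq_of_relNormTwo_eq_map_of_sub_mem hπ E hq _ (unitBallEquiv_algebraMap E _ π) hG' hN hN' h

/-! ### The Frobenius of `𝒪_E` does not depend on the Frobenius element, and is compatible with inclusions -/

/-- **Two arithmetic Frobenius elements of `Γ_F` agree on `F^{nr}`**: `σ₀'⁻¹σ₀ ∈ I_F`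
(`IsFrobPow.mul_holds`, exponents `-1 + 1 = 0`, `isFrobPow_zero_iff_mem_absInertia`) and `I_F` fixes
`F^{nr} = maxUnramified F` pointwise (`mem_absInertia_iff_forall_mem_maxUnramified`).
[cite: SerreLocalFields1979, Ch. IV §4 Cor. 2 to Prop. 16] -/
theorem smul_eq_smul_of_isAbsArithFrob {σ₀ σ₀' : absoluteGaloisGroup F} (hσ₀ : IsAbsArithFrob σ₀)
    (hσ₀' : IsAbsArithFrob σ₀') {x : AlgebraicClosure F} (hx : x ∈ maxUnramified F) :
    σ₀ • x = σ₀' • x := by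
  have h1 : IsFrobPow σ₀ 1 := IsAbsArithFrob.isFrobPow_holds hσ₀
  have h2 : IsFrobPow σ₀'⁻¹ (-1) := (IsAbsArithFrob.isFrobPow_holds hσ₀').inv
  have h3 : IsFrobPow (σ₀'⁻¹ * σ₀) 0 := by
    have := IsFrobPow.mul_holds h2 h1
    rwa [show (-1 : ℤ) + 1 = 0 by norm_num] at this
  have h4 := (mem_absInertia_iff_forall_mem_maxUnramified.mp (isFrobPow_zero_iff_mem_absInertia.mp h3)) x hx
  rw [mul_smul] at h4
  calc σ₀ • x = σ₀' • (σ₀'⁻¹ • (σ₀ • x)) := (smul_inv_smul σ₀' (σ₀ • x)).symm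
    _ = σ₀' • x := by rw [h4]

/-- ★ **The Frobenius automorphism of `𝒪_E` is well defined**: for `E ⊆ F^{nr}` finite normal over `F`,
the restrictions to `𝒪_E` of any two arithmetic Frobenius elements `σ₀, σ₀' ∈ Γ_F` coincide.
[cite: SerreLocalFields1979, Ch. IV §4 Cor. 2 to Prop. 16] -/
theorem unitBallEquiv_restrictNormal_eq_of_isAbsArithFrob [Normal F E] (hE : E ≤ maxUnramified F)
    {σ₀ σ₀' : absoluteGaloisGroup F} (hσ₀ : IsAbsArithFrob σ₀) (hσ₀' : IsAbsArithFrob σ₀') :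
    unitBallEquiv E ((absoluteGaloisGroup.toAlgEquiv F σ₀).restrictNormal E) =
      unitBallEquiv E ((absoluteGaloisGroup.toAlgEquiv F σ₀').restrictNormal E) := by
  refine RingEquiv.ext fun c => Subtype.ext ?_
  apply Subtype.ext
  rw [coe_unitBallEquiv, coe_unitBallEquiv, coe_restrictNormal_apply, coe_restrictNormal_apply]
  exact smul_eq_smul_of_isAbsArithFrob hσ₀ hσ₀' (hE (c : E).2)

/-- ★ **Compatibility of the Frobenius automorphisms with inclusions** `E₁ ≤ E₂` of finite normal
subextensions of `F̄` (both restrictions of the same `σ₀ ∈ Γ_F`): `ι ∘ φ_{E₁} = φ_{E₂} ∘ ι` on `𝒪_{E₁}`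
(`inclUnitBall`). [cite: deShalit1987, Ch. I §1.1] -/
theorem inclUnitBall_unitBallEquiv_restrictNormal {E₁ E₂ : IntermediateField F (AlgebraicClosure F)}
    [FiniteDimensional F E₁] [FiniteDimensional F E₂] [Normal F E₁] [Normal F E₂] (h : E₁ ≤ E₂)
    (σ₀ : absoluteGaloisGroup F) (c : unitBall E₁) :
    inclUnitBall (F := F) h (unitBallEquiv E₁ ((absoluteGaloisGroup.toAlgEquiv F σ₀).restrictNormal E₁) c) =
      unitBallEquiv E₂ ((absoluteGaloisGroup.toAlgEquiv F σ₀).restrictNormal E₂) (inclUnitBall (F := F) h c) := by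
  apply Subtype.ext
  apply Subtype.ext
  rw [coe_inclUnitBall, coe_unitBallEquiv, IntermediateField.coe_inclusion, coe_unitBallEquiv,
    coe_restrictNormal_apply, coe_restrictNormal_apply, coe_inclUnitBall, IntermediateField.coe_inclusion]

/-- Coefficientwise form: `map ι ∘ map φ_{E₁} = map φ_{E₂} ∘ map ι` on `𝒪_{E₁}⟦X⟧`. [cite: deShalit1987, Ch. I §1.1] -/
theorem map_inclUnitBall_map_unitBallEquiv_restrictNormal {E₁ E₂ : IntermediateField F (AlgebraicClosure F)}
    [FiniteDimensional F E₁] [FiniteDimensional F E₂] [Normal F E₁] [Normal F E₂] (h : E₁ ≤ E₂)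
    (σ₀ : absoluteGaloisGroup F) (G : PowerSeries (unitBall E₁)) :
    PowerSeries.map (inclUnitBall (F := F) h : unitBall E₁ →+* unitBall E₂)
        (PowerSeries.map (unitBallEquiv E₁ ((absoluteGaloisGroup.toAlgEquiv F σ₀).restrictNormal E₁) :
          unitBall E₁ →+* unitBall E₁) G) =
      PowerSeries.map (unitBallEquiv E₂ ((absoluteGaloisGroup.toAlgEquiv F σ₀).restrictNormal E₂) :
          unitBall E₂ →+* unitBall E₂)
        (PowerSeries.map (inclUnitBall (F := F) h : unitBall E₁ →+* unitBall E₂) G) := by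
  refine PowerSeries.ext fun n => ?_
  rw [PowerSeries.coeff_map, PowerSeries.coeff_map, PowerSeries.coeff_map, PowerSeries.coeff_map]
  exact inclUnitBall_unitBallEquiv_restrictNormal h σ₀ _

end UnramifiedFrobenius

end Literature.NumberTheory.GaloisRepresentations
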